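import Literature.Analysis.FluidPDE.LerayHopfSpectralMeasurability
import Literature.Analysis.FluidPDE.StatisticalSolutionProofs
import Literature.Analysis.FluidPDE.RestartedEnergyBound
import HarnessLib

/-!
# Leray–Hopf solutions on the torus with a steady `L²` force: uniform energy bounds

Analysis/FluidPDE support file for the discharge of
`Literature.Analysis.FluidPDE.timeAverage_isStationary` (Foias–Manley–Rosa–Temam 2001, Ch. IV
Thm. 3.1). The printed proof uses two a priori estimates for a weak solution `u` on `[0, ∞)`
of the space-periodic Navier–Stokes equations with a time-independent force `f ∈ H`
(FMRT 2001, Ch. II App. A (A.40)–(A.42), quoted in Ch. IV as (3.2) and (3.4), PDF pp. 208–210):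

* the trajectory is bounded in `H`: `|u(t)|² ≤ |u₀|² + |f|²/(ν²λ₁²)` for all `t ≥ 0`;
* the time-averaged enstrophy is bounded: `T⁻¹ ∫₀ᵀ ‖u‖² ≤ |u₀|²/(νT) + |f|²/(ν²λ₁)`.

Here they are proved for the tree's global Leray–Hopf solutions `Torus.IsGlobalLerayHopf ν
(fun _ => F) u₀ u` on `T^d` whose slices are lifted to the energy space `H`
(`U t ∈ H`, `U t = u t` a.e., the hypothesis of `timeAverage_isStationary`; it supplies the zero
mean needed by the Poincaré inequality `|u|² ≤ ‖∇u‖²`, `Torus.enorm_sq_le_eGradNormSq`, with the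
non-sharp `λ₁ = 1`):

* `IsGlobalLerayHopf.norm_sq_add_dissipation_le` — from the energy inequality between `s` and
  `t`: `|u(t)|² + ν ∫ₛᵗ ‖∇u‖² ≤ 2E(s) + (|F|²/ν)(t - s)` (Young `2(F,u) ≤ |F|²/ν + ν|u|²` and
  Poincaré integrated in time, `setIntegral_norm_sq_le_toReal_lintegral`);
* `IsGlobalLerayHopf.toReal_lintegral_eGradNormSq_le` — **(3.4)**:
  `ν ∫₀ᵀ ‖∇u‖² ≤ |u₀|² + (|F|²/ν) T`;
* `IsGlobalLerayHopf.exists_forall_integral_norm_sq_le` — **(3.2), qualitative form**: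
  `∃ R, ∀ t ≥ 0, |u(t)|² ≤ R`. A Leray–Hopf solution satisfies the energy inequality only from
  `s = 0` and from a.e. `s > 0`, so instead of the differential inequality behind (A.41) we feed
  the restarted integral inequality `y(t) + ν ∫_{(s,t]} y ≤ y(s) + C(t-s)` (a.e. `s`, all `t ≥ s`)
  to `Literature.Analysis.FluidPDE.exists_forall_le_of_restart` (`RestartedEnergyBound`).

## Mathlib / tree search

Used from the tree: `Torus.IsLerayHopfOn.aemeasurable_eGradNormSq`,
`…lintegral_eGradNormSq_lt_top`, `…integrableOn_integral_norm_sq`,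
`Torus.IsGlobalLerayHopf.memLp_two` (`LerayHopfSpectralMeasurability`, `DissipationAnomalyProofs`),
`Torus.enorm_sq_le_eGradNormSq`, `Torus.integral_norm_sq_coe_eq` (`StatisticalSolutionProofs`),
`Torus.mFourierCoeff_congr_ae`, `Torus.eGradNormSq_eq_tsum`, `integrable_inner_of_memLp_two`
(`LerayHopfProofs`); from Mathlib `integral_toReal`, `ae_lt_top'`, `integral_mono_ae`. No uniform
`L²` bound for general Leray–Hopf solutions exists in the tree (the Marchioro barrier
`GravestModeLaminarAttractorExcess` *assumes* it, `∃ K, ∀ t ≥ 0, ∫ ‖u t‖² ≤ K`).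

## References

* C. Foias, O. Manley, R. Rosa, R. Temam, *Navier–Stokes Equations and Turbulence*, Cambridge
  Univ. Press (2001), Ch. II App. A (A.40)–(A.42); Ch. IV §3.1 (3.2), (3.4), PDF pp. 208–210.
  [FMRT2001]
-/

noncomputable section

open MeasureTheory Set Filter Topology UnitAddTorus
open scoped InnerProductSpace RealInnerProductSpace ENNReal NNReal

namespace Literature.Analysis.FluidPDE.Torus

variable {d : Type*} [Fintype d] [DecidableEq d]

/-- Local notation for the real Hilbert space `L²(T^d; ℝ^d)`. -/
local notation "L2T " d':max => Lp (EuclideanSpace ℝ d') 2 (volume : Measure (UnitAddTorus d'))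

/-- Local notation for real vector fields `T^d → ℝ^d`. -/
local notation "Vec " d':max => UnitAddTorus d' → EuclideanSpace ℝ d'

/-! ### The lift to the energy space: Fourier coefficients, enstrophy, Poincaré -/

section Lift

variable {u : ℝ → Vec d} {U : ℝ → FunctionSpaces.Torus.energySpace d}

/-- The Fourier coefficients of the `H`-lift `U t` of a slice are those of the slice. [folklore] -/
theorem mFourierCoeff_coe_lift (hU : ∀ t, 0 ≤ t → ((U t : L2T d) : Vec d) =ᵐ[volume] u t)
    {t : ℝ} (ht : 0 ≤ t) (k : d → ℤ) :
    mFourierCoeff (FunctionSpaces.EuclideanSpace.complexify ∘ ((U t : L2T d) : Vec d)) k =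
      mFourierCoeff (FunctionSpaces.EuclideanSpace.complexify ∘ u t) k :=
  FunctionSpaces.Torus.mFourierCoeff_congr_ae
    ((hU t ht).fun_comp FunctionSpaces.EuclideanSpace.complexify) k

/-- The spectral enstrophy of the `H`-lift of a slice is that of the slice. [folklore] -/
theorem eGradNormSq_coe_lift (hU : ∀ t, 0 ≤ t → ((U t : L2T d) : Vec d) =ᵐ[volume] u t)
    {t : ℝ} (ht : 0 ≤ t) :
    FunctionSpaces.Torus.eGradNormSq ((U t : L2T d) : Vec d) = FunctionSpaces.Torus.eGradNormSq (u t) := by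
  rw [FunctionSpaces.Torus.eGradNormSq_eq_tsum, FunctionSpaces.Torus.eGradNormSq_eq_tsum]
  simp_rw [mFourierCoeff_coe_lift hU ht]

/-- The energy of a slice is the squared norm of its `H`-lift. [folklore] -/
theorem integral_norm_sq_eq_norm_lift_sq (hU : ∀ t, 0 ≤ t → ((U t : L2T d) : Vec d) =ᵐ[volume] u t)
    {t : ℝ} (ht : 0 ≤ t) : ∫ x, ‖u t x‖ ^ 2 = ‖(U t : L2T d)‖ ^ 2 := by
  rw [← integral_norm_sq_coe_eq]
  refine integral_congr_ae ?_
  filter_upwards [hU t ht] with x hx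
  rw [hx]

/-- **Poincaré along the lifted trajectory** (`λ₁ ≥ 1` on the unit torus, zero mean from
`U t ∈ H`): `∫ ‖u t‖² ≤ ‖∇u(t)‖₂²` in `[0, ∞]` (FMRT 2001, Ch. IV (1.13)). [cite: FMRT2001, Ch. IV §1.1 (1.13)] -/
theorem ofReal_integral_norm_sq_le_eGradNormSq_lift
    (hU : ∀ t, 0 ≤ t → ((U t : L2T d) : Vec d) =ᵐ[volume] u t) {t : ℝ} (ht : 0 ≤ t) :
    ENNReal.ofReal (∫ x, ‖u t x‖ ^ 2) ≤ FunctionSpaces.Torus.eGradNormSq (u t) := by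
  rw [integral_norm_sq_eq_norm_lift_sq hU ht, ENNReal.ofReal_pow (norm_nonneg _),
    ofReal_norm, ← eGradNormSq_coe_lift hU ht]
  exact enorm_sq_le_eGradNormSq (U t)

end Lift

/-! ### Energy estimates for a steady `L²` force -/

section Energy

variable {ν : ℝ} {F u₀ : Vec d} {u : ℝ → Vec d} {U : ℝ → FunctionSpaces.Torus.energySpace d}

omit [DecidableEq d] in
/-- **Young's inequality for the forcing term**: `(F, w) ≤ |F|²/(2ν) + (ν/2)|w|²` for `ν > 0`,
`F, w ∈ L²`. [folklore] -/
theorem integral_inner_le_young (hν : 0 < ν) (hF : MemLp F 2 volume) {w : Vec d}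
    (hw : MemLp w 2 volume) :
    ∫ x, ⟪F x, w x⟫ ≤ (∫ x, ‖F x‖ ^ 2) / (2 * ν) + ν / 2 * ∫ x, ‖w x‖ ^ 2 := by
  have hFi := hF.integrable_norm_pow two_ne_zero
  have hwi := hw.integrable_norm_pow two_ne_zero
  rw [div_eq_inv_mul, ← integral_const_mul, ← integral_const_mul, ← integral_add (hFi.const_mul _)
    (hwi.const_mul _)]
  refine integral_mono (integrable_inner_of_memLp_two hF hw) ((hFi.const_mul _).add (hwi.const_mul _))
    fun x => ?_
  have h1 : ⟪F x, w x⟫ ≤ ‖F x‖ * ‖w x‖ := real_inner_le_norm _ _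
  have h3 : ‖F x‖ * ‖w x‖ ≤ (2 * ν)⁻¹ * ‖F x‖ ^ 2 + ν / 2 * ‖w x‖ ^ 2 := by
    have key : (2 * ν)⁻¹ * ‖F x‖ ^ 2 + ν / 2 * ‖w x‖ ^ 2 - ‖F x‖ * ‖w x‖ =
        (2 * ν)⁻¹ * (‖F x‖ - ν * ‖w x‖) ^ 2 := by
      field_simp
      ring
    have hnn : 0 ≤ (2 * ν)⁻¹ * (‖F x‖ - ν * ‖w x‖) ^ 2 :=
      mul_nonneg (inv_nonneg.2 (by positivity)) (sq_nonneg _)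
    linarith
  exact h1.trans h3

/-- **Poincaré integrated in time**: for `0 ≤ s ≤ t`,
`∫_{(s,t]} |u(τ)|² dτ ≤ ∫ₛᵗ ‖∇u‖₂²` (the right side as the real part of the lower integral,
finite for Leray–Hopf solutions). [folklore] -/
theorem IsGlobalLerayHopf.setIntegral_norm_sq_le_toReal_lintegral
    (hu : IsGlobalLerayHopf ν (fun _ => F) u₀ u)
    (hU : ∀ t, 0 ≤ t → ((U t : L2T d) : Vec d) =ᵐ[volume] u t) {s t : ℝ} (hs : 0 ≤ s) (hst : s ≤ t) :
    ∫ τ in Ioc s t, (∫ x, ‖u τ x‖ ^ 2) ≤ (∫⁻ τ in Ioo s t, FunctionSpaces.Torus.eGradNormSq (u τ)).toReal := by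
  have hLH := hu (t + 1) (by linarith)
  have hsub : Ioo s t ⊆ Ioo 0 (t + 1) := Ioo_subset_Ioo hs (by linarith)
  have hmeas : AEMeasurable (fun τ => FunctionSpaces.Torus.eGradNormSq (u τ)) (volume.restrict (Ioo s t)) :=
    hLH.aemeasurable_eGradNormSq.mono_measure (Measure.restrict_mono hsub le_rfl)
  have hfin : ∫⁻ τ in Ioo s t, FunctionSpaces.Torus.eGradNormSq (u τ) < ∞ :=
    (lintegral_mono_set hsub).trans_lt hLH.lintegral_eGradNormSq_lt_top
  have hlt : ∀ᵐ τ ∂(volume.restrict (Ioo s t)), FunctionSpaces.Torus.eGradNormSq (u τ) < ∞ :=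
    ae_lt_top' hmeas hfin.ne
  have hyi : IntegrableOn (fun τ => ∫ x, ‖u τ x‖ ^ 2) (Ioo s t) :=
    hLH.integrableOn_integral_norm_sq.mono_set hsub
  rw [setIntegral_congr_set (Ioo_ae_eq_Ioc (μ := volume) (a := s) (b := t)).symm,
    ← integral_toReal hmeas hlt]
  refine integral_mono_ae hyi (integrable_toReal_of_lintegral_ne_top hmeas hfin.ne) ?_
  filter_upwards [hlt, ae_restrict_mem measurableSet_Ioo] with τ hτ hτm
  exact (ENNReal.ofReal_le_iff_le_toReal hτ.ne).1
    (ofReal_integral_norm_sq_le_eGradNormSq_lift hU (hs.trans hτm.1.le))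

/-- **The energy inequality processed**: if the Leray–Hopf energy inequality holds between
`s ≥ 0` and `t ≥ s` with initial energy `E` (that is `E = ½|u(s)|²` for a.e. `s`, or
`E = ½|u₀|²` for `s = 0`), then
`|u(t)|² + ν ∫ₛᵗ ‖∇u‖₂² ≤ 2E + (|F|²/ν)(t - s)` and `∫_{(s,t]} |u|² ≤ ∫ₛᵗ ‖∇u‖₂²`
(Young: `2(F,u) ≤ |F|²/ν + ν|u|² ≤ |F|²/ν + ν‖∇u‖²`, absorbing half of the dissipation;
FMRT 2001, Ch. II App. A (A.38)–(A.40)). [cite: FMRT2001, Ch. II App. A (A.38)–(A.40)] -/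
theorem IsGlobalLerayHopf.norm_sq_add_dissipation_le (hν : 0 < ν) (hF : MemLp F 2 volume)
    (hu : IsGlobalLerayHopf ν (fun _ => F) u₀ u)
    (hU : ∀ t, 0 ≤ t → ((U t : L2T d) : Vec d) =ᵐ[volume] u t) {s t E : ℝ} (hs : 0 ≤ s)
    (hst : s ≤ t)
    (hE : FunctionSpaces.Torus.kineticEnergy (u t) +
        ν * (∫⁻ τ in Ioo s t, FunctionSpaces.Torus.eGradNormSq (u τ)).toReal ≤
      E + ∫ τ in s..t, ∫ x, ⟪F x, u τ x⟫) :
    (∫ x, ‖u t x‖ ^ 2) + ν * (∫⁻ τ in Ioo s t, FunctionSpaces.Torus.eGradNormSq (u τ)).toReal ≤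
      2 * E + (∫ x, ‖F x‖ ^ 2) / ν * (t - s) := by
  set D : ℝ := (∫⁻ τ in Ioo s t, FunctionSpaces.Torus.eGradNormSq (u τ)).toReal with hD
  set y : ℝ → ℝ := fun τ => ∫ x, ‖u τ x‖ ^ 2 with hy
  set A : ℝ := (∫ x, ‖F x‖ ^ 2) / (2 * ν) with hA
  have hA0 : 0 ≤ A := div_nonneg (integral_nonneg fun x => sq_nonneg _) (by positivity)
  have hy0 : ∀ τ, 0 ≤ y τ := fun τ => integral_nonneg fun x => sq_nonneg _
  -- the forcing term: `∫ₛᵗ (F, u) ≤ A (t - s) + (ν/2) ∫_{(s,t]} y`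
  have hyi : IntegrableOn y (Ioc s t) := by
    rcases eq_or_lt_of_le (hs.trans hst) with ht0 | ht0
    · have : Ioc s t = ∅ := Ioc_eq_empty (by rw [← ht0]; exact not_lt.2 hs)
      rw [this]
      exact integrableOn_empty
    · exact (hu.integrableOn_integral_norm_sq ht0).mono_set (Ioc_subset_Ioc_left hs)
  have hforce : ∫ τ in s..t, ∫ x, ⟪F x, u τ x⟫ ≤ A * (t - s) + ν / 2 * ∫ τ in Ioc s t, y τ := by
    rw [intervalIntegral.integral_of_le hst]
    haveI : IsFiniteMeasure (volume.restrict (Ioc s t)) :=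
      ⟨by rw [Measure.restrict_apply_univ]; exact measure_Ioc_lt_top⟩
    have hAi : Integrable (fun _ : ℝ => A) (volume.restrict (Ioc s t)) := integrable_const A
    have hrhs : A * (t - s) + ν / 2 * ∫ τ in Ioc s t, y τ = ∫ τ in Ioc s t, (A + ν / 2 * y τ) := by
      rw [integral_add hAi (hyi.const_mul _), integral_const_mul,
        setIntegral_const, Real.volume_real_Ioc_of_le hst, smul_eq_mul, mul_comm]
    by_cases hint : IntegrableOn (fun τ => ∫ x, ⟪F x, u τ x⟫) (Ioc s t)
    · rw [hrhs]
      refine integral_mono_ae hint (hAi.add (hyi.const_mul _)) ?_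
      filter_upwards [ae_restrict_mem measurableSet_Ioc] with τ hτ
      exact integral_inner_le_young hν hF (hu.memLp_two (hs.trans hτ.1.le))
    · rw [integral_undef hint]
      exact add_nonneg (mul_nonneg hA0 (sub_nonneg.2 hst))
        (mul_nonneg (by positivity) (setIntegral_nonneg measurableSet_Ioc fun τ _ => hy0 τ))
  -- Poincaré integrated in time: `∫_{(s,t]} y ≤ D`
  have hP : ∫ τ in Ioc s t, y τ ≤ D := hu.setIntegral_norm_sq_le_toReal_lintegral hU hs hst
  -- assemble
  have hkin : FunctionSpaces.Torus.kineticEnergy (u t) = 2⁻¹ * y t := rfl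
  rw [hkin] at hE
  have h2A : 2 * A = (∫ x, ‖F x‖ ^ 2) / ν := by
    rw [hA]; field_simp
  rw [← h2A]
  nlinarith [hE, hforce, hP, hν]

/-- **Time-averaged enstrophy bound, FMRT (3.4)** (with `λ₁ = 1`): for a global Leray–Hopf
solution with steady force `F ∈ L²` and mean-zero slices,
`ν ∫₀ᵀ ‖∇u‖₂² ≤ |u₀|² + (|F|²/ν) T` for every `T ≥ 0` — the energy inequality from `0` processed
by `norm_sq_add_dissipation_le` (FMRT 2001, Ch. IV (3.4); Ch. II (A.40)). Here
`|u₀|² = 2 · kineticEnergy u₀`. [cite: FMRT2001, Ch. IV §3.1 (3.4)] -/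
theorem IsGlobalLerayHopf.toReal_lintegral_eGradNormSq_le (hν : 0 < ν) (hF : MemLp F 2 volume)
    (hu : IsGlobalLerayHopf ν (fun _ => F) u₀ u)
    (hU : ∀ t, 0 ≤ t → ((U t : L2T d) : Vec d) =ᵐ[volume] u t) {T : ℝ} (hT : 0 ≤ T) :
    ν * (∫⁻ τ in Ioo 0 T, FunctionSpaces.Torus.eGradNormSq (u τ)).toReal ≤
      2 * FunctionSpaces.Torus.kineticEnergy u₀ + (∫ x, ‖F x‖ ^ 2) / ν * T := by
  have hE := (hu (T + 1) (by linarith)).energy_ineq_zero T ⟨hT, by linarith⟩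
  have h := hu.norm_sq_add_dissipation_le hν hF hU le_rfl hT hE
  rw [sub_zero] at h
  have h0 : 0 ≤ ∫ x, ‖u T x‖ ^ 2 := integral_nonneg fun x => sq_nonneg _
  linarith

/-- **The trajectory is bounded in `L²` uniformly in time, FMRT (3.2)/(A.42), qualitative
form**: for a global Leray–Hopf solution on `T^d` with viscosity `ν > 0`, steady force
`F ∈ L²` and slices lifted to `H` (zero mean), there is `R` with `∫ ‖u(t)‖² ≤ R` for **every**
`t ≥ 0`. Proof: the energy inequalities from `0` and from a.e. `s > 0` give, after
`norm_sq_add_dissipation_le`, the restarted integral inequality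
`y(t) + ν ∫_{(s,t]} y ≤ y(s) + (|F|²/ν)(t - s)` for the energy `y` (with `y(0)` read as `|u₀|²`),
to which `Literature.Analysis.FluidPDE.exists_forall_le_of_restart` applies (FMRT 2001, Ch. II (A.41)–(A.42);
Ch. IV (3.2)). [cite: FMRT2001, Ch. IV §3.1 (3.2)] -/
theorem IsGlobalLerayHopf.exists_forall_integral_norm_sq_le (hν : 0 < ν) (hF : MemLp F 2 volume)
    (hu : IsGlobalLerayHopf ν (fun _ => F) u₀ u)
    (hU : ∀ t, 0 ≤ t → ((U t : L2T d) : Vec d) =ᵐ[volume] u t) :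
    ∃ R : ℝ, ∀ t, 0 ≤ t → ∫ x, ‖u t x‖ ^ 2 ≤ R := by
  classical
  set C : ℝ := (∫ x, ‖F x‖ ^ 2) / ν with hC
  have hC0 : 0 ≤ C := div_nonneg (integral_nonneg fun x => sq_nonneg _) hν.le
  set E₀ : ℝ := 2 * FunctionSpaces.Torus.kineticEnergy u₀ with hE₀
  have hE₀0 : 0 ≤ E₀ := mul_nonneg zero_le_two (FunctionSpaces.Torus.kineticEnergy_nonneg _)
  -- the energy with `y 0` read as `|u₀|²`
  set y : ℝ → ℝ := fun t => if t = 0 then E₀ else ∫ x, ‖u t x‖ ^ 2 with hy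
  have hy_of_pos : ∀ t, 0 < t → y t = ∫ x, ‖u t x‖ ^ 2 := fun t ht => by
    simp [hy, ht.ne']
  have hy0 : ∀ t, 0 ≤ y t := fun t => by
    by_cases ht : t = 0
    · simp [hy, ht, hE₀0]
    · simp only [hy, ht, if_false]; exact integral_nonneg fun x => sq_nonneg _
  have hyI : ∀ s t, 0 ≤ s → ∫ τ in Ioc s t, y τ = ∫ τ in Ioc s t, (∫ x, ‖u τ x‖ ^ 2) :=
    fun s t hs => setIntegral_congr_fun measurableSet_Ioc fun τ hτ => hy_of_pos τ (hs.trans_lt hτ.1)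
  have hyi : ∀ T, IntegrableOn y (Ioc 0 T) := by
    intro T
    rcases le_or_gt T 0 with hT | hT
    · rw [Ioc_eq_empty (not_lt.2 hT)]
      exact integrableOn_empty
    · exact (hu.integrableOn_integral_norm_sq hT).congr_fun
        (fun τ hτ => (hy_of_pos τ hτ.1).symm) measurableSet_Ioc
  -- the good initial times
  set G : Set ℝ := {s | 0 ≤ s ∧ ∀ t, s ≤ t →
    y t + ν * ∫ τ in Ioc s t, y τ ≤ y s + C * (t - s)} with hG
  -- `0 ∈ G`: the energy inequality from `0`
  have h0 : (0 : ℝ) ∈ G := by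
    refine ⟨le_rfl, fun t ht => ?_⟩
    rcases eq_or_lt_of_le ht with ht0 | ht0
    · subst ht0
      simp
    · have hE := (hu (t + 1) (by linarith)).energy_ineq_zero t ⟨ht, by linarith⟩
      have h := hu.norm_sq_add_dissipation_le hν hF hU le_rfl ht hE
      have hP := hu.setIntegral_norm_sq_le_toReal_lintegral hU le_rfl ht
      rw [hyI 0 t le_rfl, hy_of_pos t ht0]
      have hy00 : y 0 = E₀ := by simp [hy]
      rw [hy00]
      nlinarith [hν, h, hP]
  -- a.e. `s > 0` lies in `G`: the energy inequality from a.e. `s`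
  have hG' : ∀ᵐ s ∂volume, 0 < s → s ∈ G := by
    have hn : ∀ n : ℕ, ∀ᵐ s ∂volume, s ∈ Ioo (0 : ℝ) (n + 1) → ∀ t ∈ Icc s ((n : ℝ) + 1),
        FunctionSpaces.Torus.kineticEnergy (u t) +
            ν * (∫⁻ τ in Ioo s t, FunctionSpaces.Torus.eGradNormSq (u τ)).toReal ≤
          FunctionSpaces.Torus.kineticEnergy (u s) + ∫ τ in s..t, ∫ x, ⟪F x, u τ x⟫ := fun n =>
      (ae_restrict_iff' measurableSet_Ioo).1
        (hu ((n : ℝ) + 1) (by positivity)).energy_ineq_ae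
    rw [← ae_all_iff] at hn
    filter_upwards [hn] with s hs hs0
    refine ⟨hs0.le, fun t hst => ?_⟩
    obtain ⟨n, hn'⟩ := exists_nat_gt t
    have hE := hs n ⟨hs0, by linarith⟩ t ⟨hst, by linarith⟩
    have h := hu.norm_sq_add_dissipation_le hν hF hU hs0.le hst hE
    have hP := hu.setIntegral_norm_sq_le_toReal_lintegral hU hs0.le hst
    rw [hyI s t hs0.le, hy_of_pos t (hs0.trans_le hst), hy_of_pos s hs0]
    have hkin : FunctionSpaces.Torus.kineticEnergy (u s) = 2⁻¹ * ∫ x, ‖u s x‖ ^ 2 := rfl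
    rw [hkin] at h
    nlinarith [hν, h, hP]
  obtain ⟨R, hR⟩ := exists_forall_le_of_restart hν hC0 hy0 hyi (fun s hs => hs.1) h0 hG'
    (fun s hs t hst => hs.2 t hst)
  refine ⟨R, fun t ht => ?_⟩
  rcases eq_or_lt_of_le ht with ht0 | ht0
  · -- `t = 0`: `|u(0)|² ≤ |u₀|²` from the energy inequality at `t = 0`
    subst ht0
    have hE := (hu 1 one_pos).energy_ineq_zero 0 ⟨le_rfl, zero_le_one⟩
    rw [intervalIntegral.integral_same, add_zero] at hE
    have hD : 0 ≤ ν * (∫⁻ τ in Ioo (0 : ℝ) 0, FunctionSpaces.Torus.eGradNormSq (u τ)).toReal :=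
      mul_nonneg hν.le ENNReal.toReal_nonneg
    have hkin : FunctionSpaces.Torus.kineticEnergy (u 0) = 2⁻¹ * ∫ x, ‖u 0 x‖ ^ 2 := rfl
    have hkin0 : FunctionSpaces.Torus.kineticEnergy u₀ = 2⁻¹ * E₀ := by
      rw [hE₀]; ring
    have hR0 := hR 0 le_rfl
    have hy00 : y 0 = E₀ := by simp [hy]
    rw [hy00] at hR0
    rw [hkin, hkin0] at hE
    linarith
  · rw [← hy_of_pos t ht0]
    exact hR t ht

end Energy

end Literature.Analysis.FluidPDE.Torus
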